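import Mathlib
import Literature.NumberTheory.LFunctions.RationalExpSumLFunction
import Literature.NumberTheory.LFunctions.RationalExpSumInvariance
import HarnessLib

/-!
# `h ↦ ψ(Σ_{h(β)=0} P(β)/Q(β))` is a character modulo `Q²`: vanishing of the `L`-coefficients
# (Schmidt, Ch. II §9, for rational arguments)

Topic `Literature/NumberTheory/LFunctions` (exponential sums), grouping namespace
`RationalExpSum` (fourth file; see `RationalExpSumNewton`, `RationalExpSumLFunction`,
`RationalExpSumInvariance`).  For `P, Q ∈ F[X]` over a finite field `F` with `deg P ≤ deg Q`,
`deg Q ≥ 1`, we descend the root sums to `F` and obtain the character structure of the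
completely multiplicative function `lam ψ P Q` of `RationalExpSumLFunction`:

* `traceFn P Q h = Σ_{π ∈ normalizedFactors h} traceTerm P Q π ∈ F`, with
  `algebraMap F L (traceFn P Q h) = rootSum L P Q h` (`algebraMap_traceFn`, via
  `trace_eq_sum_embeddings`), hence (`traceFn_eq_of_sq_dvd_sub`) `traceFn h` depends only on
  `deg h` and `h mod Q²` for monic `h` coprime to `Q`; and `lam ψ P Q h = ψ(traceFn P Q h)` for
  such `h`, `= 0` for monic `h` not coprime to `Q` (`lam_eq_psi_traceFn`, `lam_eq_zero_of_not_isCoprime`);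
* with `M = (lc(Q)⁻¹ Q)²` (monic of degree `μ = 2 deg Q`), representatives
  `rep n ρ = X^{n−μ} M + ρ` and `tFn n ρ = traceFn (rep n ρ)`, the **homomorphism**
  `D ρ = tFn μ ρ − tFn μ 1` on the residues `ρ` (`deg ρ < μ`, `ρ` coprime to `Q`) under
  multiplication modulo `M` (`D_mul_mod`), with `tFn n ρ = tFn n 1 + D ρ` (`tFn_eq`);
* **the `L`-coefficients factor** (`lsumOf_lam_eq`):
  `lsumOf (lam ψ P Q) (m + μ) = q^m ψ(tFn (m+μ) 1) · Σ_ρ ψ(D ρ)`;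
* **the dichotomy**: if `ψ(D ρ₀) ≠ 1` for some residue `ρ₀` then `Σ_ρ ψ(D ρ) = 0` (orbit under
  `ρ ↦ ρ₀ρ mod M`) and so `lsumOf (lam ψ P Q) n = 0` for all `n ≥ μ` (`lsumOf_lam_eq_zero`) — the
  `L`-function is a polynomial of degree `< μ`; if instead `D ≡ 0` then `lam ψ P Q h = ψ(tFn n 1)`
  for every monic `h` of degree `n ≥ μ` coprime to `Q` (`lam_eq_const_of_D_eq_zero`) — the
  degenerate case, excluded downstream by the Riemann hypothesis for the Artin–Schreier curve.

Everything is proved; no named facts.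

## References

* W. M. Schmidt, *Equations over Finite Fields. An Elementary Approach*, LNM 536 (1976),
  Ch. II §8 (Theorem 8A), §9 (Lemmas 9A–9C). [`Schmidt1976`]
* A. Weil, *On some exponential sums*, Proc. Nat. Acad. Sci. USA 34 (1948) 204–207. [`Weil1948`]
-/

noncomputable section

open Finset Polynomial

namespace Literature.NumberTheory.LFunctions

namespace RationalExpSum

open KloostermanLFunction (monics mem_monics sum_monics card_monics)
open HybridLFunction (IsMonicMul lsumOf psumOf lowPoly degree_lowPoly_lt eq_lowPoly_of_degree_lt
  lowPoly_injective)
open UniqueFactorizationMonoid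

/-! ### §1. Descent of the root sums to `F` -/

section Descent

variable {F : Type*} [Field F] [Fintype F] [DecidableEq F]
variable {L : Type*} [Field L] [Algebra F L] [IsAlgClosed L] [DecidableEq L]

omit [DecidableEq F] in
/-- **The trace term is the root sum**: for a monic irreducible `π` over the (perfect) finite
field `F`, `algebraMap F L (traceTerm P Q π) = Σ_{π(β)=0} P(β)/Q(β)` in an algebraically closed
`L ⊇ F` (the trace is the sum of the conjugates; Schmidt II §9, `[g/h] = Σ_{h(β)=0} g(β)`).
[cite: Schmidt1976, Ch. II §9 p. 64 and §10 (10.5)] -/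
theorem algebraMap_traceTerm (P Q : F[X]) {π : F[X]} (hm : π.Monic) (hirr : Irreducible π) :
    algebraMap F L (traceTerm P Q π) = rootSum L P Q π := by
  haveI : Fact (Irreducible π) := ⟨hirr⟩
  have hπ0 : π ≠ 0 := hm.ne_zero
  haveI : Module.Finite F (AdjoinRoot π) := (AdjoinRoot.powerBasis hπ0).finite
  unfold traceTerm
  rw [dif_pos hirr, trace_eq_sum_embeddings L]
  -- each embedding `σ` contributes `P(σθ)/Q(σθ)`
  have hσ : ∀ σ : AdjoinRoot π →ₐ[F] L, σ (AdjoinRoot.mk π P / AdjoinRoot.mk π Q) =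
      aeval (σ (AdjoinRoot.root π)) P / aeval (σ (AdjoinRoot.root π)) Q := by
    intro σ
    rw [map_div₀, ← AdjoinRoot.aeval_eq, ← AdjoinRoot.aeval_eq, aeval_algHom_apply, aeval_algHom_apply]
  simp_rw [hσ]
  -- reindex the embeddings by the roots of `π` in `L`
  rw [← Equiv.sum_comp (AdjoinRoot.equiv L F π hπ0).symm]
  have hcoe : ∀ x : {x // x ∈ π.aroots L},
      ((AdjoinRoot.equiv L F π hπ0).symm x) (AdjoinRoot.root π) = (x : L) := by
    intro x
    have := congrArg (fun y : {x // x ∈ π.aroots L} => (y : L))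
      ((AdjoinRoot.equiv L F π hπ0).apply_symm_apply x)
    exact this
  simp_rw [hcoe]
  -- the roots of `π` in `L` are simple
  have hnodup : (π.aroots L).Nodup :=
    nodup_roots ((separable_map _).mpr (PerfectField.separable_of_irreducible hirr))
  have hset : ((π.aroots L).map fun β => aeval β P / aeval β Q).sum =
      ∑ β ∈ (π.aroots L).toFinset, aeval β P / aeval β Q := by
    rw [Finset.sum_eq_multiset_sum, Multiset.toFinset_val, hnodup.dedup]
  show ∑ x : {x // x ∈ π.aroots L}, aeval (x : L) P / aeval (x : L) Q =
    ((π.aroots L).map fun β => aeval β P / aeval β Q).sum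
  rw [hset]
  symm
  convert Finset.sum_subtype ((π.aroots L).toFinset) (p := fun x => x ∈ π.aroots L)
    (fun x => Multiset.mem_toFinset) (fun β => aeval β P / aeval β Q)

omit [IsAlgClosed L] [DecidableEq L] [Fintype F] in
/-- **The trace function** `Σ_{π ∈ normalizedFactors h} traceTerm P Q π ∈ F` (the descent of the
root sum `[R/h]` to the ground field). [cite: Schmidt1976, Ch. II §9, p. 64] -/
def traceFn (P Q h : F[X]) : F :=
  ((normalizedFactors h).map (traceTerm P Q)).sum

/-- For monic `h`, `algebraMap F L (traceFn P Q h) = rootSum L P Q h`. [cite: Schmidt1976, Ch. II §9, Lemma 9A] -/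
theorem algebraMap_traceFn (P Q : F[X]) {h : F[X]} (hm : h.Monic) :
    algebraMap F L (traceFn P Q h) = rootSum L P Q h := by
  have h0 : h ≠ 0 := hm.ne_zero
  have hnf : ∀ π ∈ normalizedFactors h, π.Monic ∧ Irreducible π := fun π hπ => by
    have := (Polynomial.mem_normalizedFactors_iff h0).mp hπ
    exact ⟨this.2.1, this.1⟩
  have hprod : (normalizedFactors h).prod = h := by
    have hprodm : (normalizedFactors h).prod.Monic := by
      have := monic_multiset_prod_of_monic (normalizedFactors h) id fun π hπ => (hnf π hπ).1
      rwa [Multiset.map_id] at this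
    exact eq_of_monic_of_associated hprodm hm (prod_normalizedFactors h0)
  unfold traceFn
  rw [map_multiset_sum, Multiset.map_map]
  conv_rhs => rw [← hprod]
  rw [rootSum_multiset_prod P Q _ fun π hπ => (hnf π hπ).1.ne_zero]
  congr 1
  exact Multiset.map_congr rfl fun π hπ => algebraMap_traceTerm P Q (hnf π hπ).1 (hnf π hπ).2

omit [IsAlgClosed L] [DecidableEq L] [Fintype F] in
/-- Additivity: `traceFn (g h) = traceFn g + traceFn h` for `g, h ≠ 0`. [cite: Schmidt1976, Ch. II §9, Lemma 9A] -/
theorem traceFn_mul (P Q : F[X]) {g h : F[X]} (hg : g ≠ 0) (hh : h ≠ 0) :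
    traceFn P Q (g * h) = traceFn P Q g + traceFn P Q h := by
  unfold traceFn; rw [normalizedFactors_mul hg hh, Multiset.map_add, Multiset.sum_add]

omit [DecidableEq L] in
/-- **Invariance on the ground field**: for `Q ≠ 0`, `deg P ≤ deg Q`, monic `h₁, h₂` of the same
degree, coprime to `Q`, with `Q² ∣ h₁ − h₂`: `traceFn P Q h₁ = traceFn P Q h₂`.
[cite: Schmidt1976, Ch. II §9, Lemma 9B (for rational arguments)] -/
theorem traceFn_eq_of_sq_dvd_sub {P Q : F[X]} (hQ0 : Q ≠ 0) (hPQ : P.natDegree ≤ Q.natDegree)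
    {h₁ h₂ : F[X]} (hm₁ : h₁.Monic) (hm₂ : h₂.Monic) (hdeg : h₁.natDegree = h₂.natDegree)
    (hc₁ : IsCoprime h₁ Q) (hc₂ : IsCoprime h₂ Q) (hdvd : Q ^ 2 ∣ h₁ - h₂) :
    traceFn P Q h₁ = traceFn P Q h₂ := by
  classical
  apply (algebraMap F (AlgebraicClosure F)).injective
  rw [algebraMap_traceFn P Q hm₁, algebraMap_traceFn P Q hm₂]
  exact rootSum_eq_of_sq_dvd_sub hQ0 hPQ hm₁ hm₂ hdeg hc₁ hc₂ hdvd

omit [IsAlgClosed L] [DecidableEq L] [Fintype F] [DecidableEq F] in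
/-- `ψ` of a multiset sum is the product. [folklore] -/
theorem psi_multiset_sum (ψ : AddChar F ℂ) (s : Multiset F) : ψ s.sum = (s.map ψ).prod := by
  induction s using Multiset.induction_on with
  | empty => simp
  | cons a s ih => rw [Multiset.sum_cons, AddChar.map_add_eq_mul, Multiset.map_cons, Multiset.prod_cons, ih]

omit [IsAlgClosed L] [DecidableEq L] [Fintype F] in
/-- **`λ(h) = ψ(traceFn h)`** for monic `h` coprime to `Q`. [cite: Schmidt1976, Ch. II §9, p. 64] -/
theorem lam_eq_psi_traceFn (ψ : AddChar F ℂ) (P Q : F[X]) {h : F[X]} (hm : h.Monic)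
    (hcop : IsCoprime h Q) : lam ψ P Q h = ψ (traceFn P Q h) := by
  have h0 : h ≠ 0 := hm.ne_zero
  unfold lam traceFn
  rw [psi_multiset_sum, Multiset.map_map]
  congr 1
  refine Multiset.map_congr rfl fun π hπ => ?_
  have hπ := (Polynomial.mem_normalizedFactors_iff h0).mp hπ
  have hndvd : ¬ π ∣ Q := fun hdvd => hπ.1.not_isUnit (hcop.isUnit_of_dvd' hπ.2.2 hdvd)
  simp only [Function.comp_apply, lamIrr, if_neg hndvd]

omit [IsAlgClosed L] [DecidableEq L] [Fintype F] in
/-- **`λ(h) = 0`** for monic `h` NOT coprime to `Q` (a common irreducible factor `π ∣ Q` has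
`λ₀(π) = 0`). [cite: Schmidt1976, Ch. II §8 (X(h) = 0 off the group)] -/
theorem lam_eq_zero_of_not_isCoprime (ψ : AddChar F ℂ) (P Q : F[X]) {h : F[X]} (hm : h.Monic)
    (hcop : ¬ IsCoprime h Q) : lam ψ P Q h = 0 := by
  have h0 : h ≠ 0 := hm.ne_zero
  -- a common irreducible factor
  classical
  have hg : ¬ IsUnit (EuclideanDomain.gcd h Q) := fun hu => hcop (by
    obtain ⟨a, b, hab⟩ : ∃ a b, EuclideanDomain.gcd h Q = h * a + Q * b :=
      ⟨EuclideanDomain.gcdA h Q, EuclideanDomain.gcdB h Q, EuclideanDomain.gcd_eq_gcd_ab h Q⟩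
    obtain ⟨u, hu⟩ := hu
    refine ⟨a * ↑u⁻¹, b * ↑u⁻¹, ?_⟩
    calc a * ↑u⁻¹ * h + b * ↑u⁻¹ * Q = (h * a + Q * b) * ↑u⁻¹ := by ring
      _ = 1 := by rw [← hab, ← hu, Units.mul_inv])
  have hg0 : EuclideanDomain.gcd h Q ≠ 0 := fun h00 => by
    have := EuclideanDomain.gcd_dvd_left h Q
    rw [h00, zero_dvd_iff] at this
    exact h0 this
  obtain ⟨π, hπirr, hπdvd⟩ := WfDvdMonoid.exists_irreducible_factor hg hg0
  have hπh : π ∣ h := hπdvd.trans (EuclideanDomain.gcd_dvd_left h Q)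
  have hπQ : π ∣ Q := hπdvd.trans (EuclideanDomain.gcd_dvd_right h Q)
  obtain ⟨π', hπ'mem, hassoc⟩ := exists_mem_normalizedFactors_of_dvd h0 hπirr hπh
  have hπ'Q : π' ∣ Q := hassoc.symm.dvd.trans hπQ
  unfold lam
  apply Multiset.prod_eq_zero
  rw [Multiset.mem_map]
  exact ⟨π', hπ'mem, by unfold lamIrr; exact if_pos hπ'Q⟩

end Descent

/-! ### §2. Residues modulo `M = (lc⁻¹ Q)²`, representatives and the homomorphism `D` -/

section Residues

variable {F : Type*} [Field F] [Fintype F] [DecidableEq F]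

/-- The monic modulus `M = (lc(Q)⁻¹ Q)²`. [folklore] -/
def modulusSq (Q : F[X]) : F[X] := (Q * C (Q.leadingCoeff)⁻¹) ^ 2

omit [Fintype F] [DecidableEq F] in
/-- `M` is monic for `Q ≠ 0`. [folklore] -/
theorem monic_modulusSq {Q : F[X]} (hQ0 : Q ≠ 0) : (modulusSq Q).Monic := by
  unfold modulusSq
  exact (monic_mul_leadingCoeff_inv hQ0).pow 2

omit [Fintype F] [DecidableEq F] in
/-- `deg M = 2 deg Q`. [folklore] -/
theorem natDegree_modulusSq {Q : F[X]} (hQ0 : Q ≠ 0) : (modulusSq Q).natDegree = 2 * Q.natDegree := by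
  unfold modulusSq
  rw [natDegree_pow, natDegree_mul_leadingCoeff_inv _ hQ0]

omit [Fintype F] [DecidableEq F] in
/-- `Q² ∣ M · (lc Q)²`, more usefully: `M ∣ A − B → Q² ∣ A − B`. [folklore] -/
theorem sq_dvd_of_modulusSq_dvd {Q A B : F[X]} (hQ0 : Q ≠ 0) (h : modulusSq Q ∣ A - B) :
    Q ^ 2 ∣ A - B := by
  have hlc : Q.leadingCoeff ≠ 0 := leadingCoeff_ne_zero.mpr hQ0
  have hQM' : modulusSq Q * C (Q.leadingCoeff ^ 2) = Q ^ 2 := by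
    unfold modulusSq
    rw [mul_pow, ← C_pow, mul_assoc, ← C_mul, inv_pow, inv_mul_cancel₀ (pow_ne_zero 2 hlc), C_1,
      mul_one]
  have hQM : Q ^ 2 ∣ modulusSq Q * C (Q.leadingCoeff ^ 2) := ⟨1, by rw [hQM', mul_one]⟩
  have hunit : IsUnit (C (Q.leadingCoeff ^ 2) : F[X]) := isUnit_C.mpr (IsUnit.mk0 _ (pow_ne_zero 2 hlc))
  exact (hunit.dvd_mul_right.mp hQM).trans h

omit [Fintype F] [DecidableEq F] in
/-- `Q ∣ M`. [folklore] -/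
theorem dvd_modulusSq (Q : F[X]) : Q ∣ modulusSq Q := by
  unfold modulusSq
  exact Dvd.intro (C (Q.leadingCoeff)⁻¹ * (Q * C (Q.leadingCoeff)⁻¹)) (by ring)

omit [Fintype F] [DecidableEq F] in
/-- Coprimality with `Q` is stable under adding a multiple of `M`. [folklore] -/
theorem isCoprime_add_mul_modulusSq_iff (Q A B : F[X]) :
    IsCoprime (A + B * modulusSq Q) Q ↔ IsCoprime A Q := by
  obtain ⟨k, hk⟩ := dvd_modulusSq Q
  rw [hk, show A + B * (Q * k) = A + Q * (B * k) by ring]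
  exact ⟨fun h => h.of_add_mul_left_left, fun h => h.add_mul_left_left _⟩

/-- The representative `rep n ρ = X^{n − μ} M + ρ` of the residue `ρ` in degree `n`. [folklore] -/
def rep (Q : F[X]) (n : ℕ) (ρ : F[X]) : F[X] := X ^ (n - (modulusSq Q).natDegree) * modulusSq Q + ρ

omit [Fintype F] [DecidableEq F] in
/-- For `deg ρ < μ ≤ n`, `rep n ρ` is monic of degree `n`. [folklore] -/
theorem monic_rep_and_natDegree {Q : F[X]} (hQ0 : Q ≠ 0) {n : ℕ} (hn : (modulusSq Q).natDegree ≤ n)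
    {ρ : F[X]} (hρ : ρ.degree < (modulusSq Q).natDegree) :
    (rep Q n ρ).Monic ∧ (rep Q n ρ).natDegree = n := by
  have hM := monic_modulusSq hQ0
  have hXM : (X ^ (n - (modulusSq Q).natDegree) * modulusSq Q).Monic := (monic_X_pow _).mul hM
  have hXMd : (X ^ (n - (modulusSq Q).natDegree) * modulusSq Q).natDegree = n := by
    rw [(monic_X_pow _).natDegree_mul hM, natDegree_X_pow, Nat.sub_add_cancel hn]
  have hlt : ρ.degree < (X ^ (n - (modulusSq Q).natDegree) * modulusSq Q).degree := by
    rw [degree_eq_natDegree hXM.ne_zero, hXMd]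
    exact hρ.trans_le (by exact_mod_cast hn)
  unfold rep
  exact ⟨hXM.add_of_left hlt, by rw [natDegree_add_eq_left_of_degree_lt hlt, hXMd]⟩

omit [Fintype F] [DecidableEq F] in
/-- `rep n ρ ≡ ρ (mod M)`. [folklore] -/
theorem modulusSq_dvd_rep_sub {Q : F[X]} (n : ℕ) (ρ : F[X]) : modulusSq Q ∣ rep Q n ρ - ρ := by
  unfold rep; exact Dvd.intro_left (X ^ (n - (modulusSq Q).natDegree)) (by ring)

/-- `tFn n ρ = traceFn (rep n ρ)`. [folklore] -/
def tFn (P Q : F[X]) (n : ℕ) (ρ : F[X]) : F := traceFn P Q (rep Q n ρ)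

/-- **`traceFn` on a congruence class**: for monic `h` of degree `n ≥ μ` coprime to `Q`,
`traceFn h = tFn n (h mod M)`. [cite: Schmidt1976, Ch. II §9, Lemma 9B] -/
theorem traceFn_eq_tFn {P Q : F[X]} (hQ0 : Q ≠ 0) (hPQ : P.natDegree ≤ Q.natDegree) {h : F[X]}
    (hm : h.Monic) {n : ℕ} (hd : h.natDegree = n) (hn : (modulusSq Q).natDegree ≤ n)
    (hcop : IsCoprime h Q) : traceFn P Q h = tFn P Q n (h %ₘ modulusSq Q) := by
  have hM := monic_modulusSq hQ0
  set ρ := h %ₘ modulusSq Q with hρ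
  have hρdeg : ρ.degree < (modulusSq Q).natDegree := by
    rw [← degree_eq_natDegree hM.ne_zero]; exact degree_modByMonic_lt h hM
  obtain ⟨hrm, hrd⟩ := monic_rep_and_natDegree hQ0 hn hρdeg
  -- `h ≡ ρ ≡ rep n ρ (mod M)`
  have hhρ : modulusSq Q ∣ h - ρ := by
    rw [hρ, modByMonic_eq_sub_mul_div h (modulusSq Q)]; exact Dvd.intro (h /ₘ modulusSq Q) (by ring)
  have hdvdM : modulusSq Q ∣ h - rep Q n ρ := by
    have := dvd_sub hhρ (modulusSq_dvd_rep_sub (Q := Q) n ρ)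
    rwa [sub_sub_sub_cancel_right] at this
  have hcop' : IsCoprime (rep Q n ρ) Q := by
    obtain ⟨k, hk⟩ := hdvdM
    have : rep Q n ρ = h + (-k) * modulusSq Q := by linear_combination -hk
    rw [this, isCoprime_add_mul_modulusSq_iff Q]
    exact hcop
  unfold tFn
  exact traceFn_eq_of_sq_dvd_sub hQ0 hPQ hm hrm (hd.trans hrd.symm) hcop hcop'
    (sq_dvd_of_modulusSq_dvd hQ0 hdvdM)

/-- **Additivity across degrees**: for residues `ρ₁, ρ₂` (degree `< μ`, coprime to `Q`) and
`n₁, n₂ ≥ μ`, `tFn (n₁ + n₂) ((ρ₁ ρ₂) mod M) = tFn n₁ ρ₁ + tFn n₂ ρ₂`.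
[cite: Schmidt1976, Ch. II §9, Lemma 9A] -/
theorem tFn_add {P Q : F[X]} (hQ0 : Q ≠ 0) (hPQ : P.natDegree ≤ Q.natDegree) {n₁ n₂ : ℕ}
    (hn₁ : (modulusSq Q).natDegree ≤ n₁) (hn₂ : (modulusSq Q).natDegree ≤ n₂) {ρ₁ ρ₂ : F[X]}
    (hρ₁ : ρ₁.degree < (modulusSq Q).natDegree) (hρ₂ : ρ₂.degree < (modulusSq Q).natDegree)
    (hc₁ : IsCoprime ρ₁ Q) (hc₂ : IsCoprime ρ₂ Q) :
    tFn P Q (n₁ + n₂) ((ρ₁ * ρ₂) %ₘ modulusSq Q) = tFn P Q n₁ ρ₁ + tFn P Q n₂ ρ₂ := by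
  have hM := monic_modulusSq hQ0
  obtain ⟨hm₁, hd₁⟩ := monic_rep_and_natDegree hQ0 hn₁ hρ₁
  obtain ⟨hm₂, hd₂⟩ := monic_rep_and_natDegree hQ0 hn₂ hρ₂
  have hcop₁ : IsCoprime (rep Q n₁ ρ₁) Q := by
    unfold rep; rw [add_comm, isCoprime_add_mul_modulusSq_iff Q]; exact hc₁
  have hcop₂ : IsCoprime (rep Q n₂ ρ₂) Q := by
    unfold rep; rw [add_comm, isCoprime_add_mul_modulusSq_iff Q]; exact hc₂
  set h := rep Q n₁ ρ₁ * rep Q n₂ ρ₂ with hh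
  have hhm : h.Monic := hm₁.mul hm₂
  have hhd : h.natDegree = n₁ + n₂ := by rw [hh, hm₁.natDegree_mul hm₂, hd₁, hd₂]
  have hhcop : IsCoprime h Q := IsCoprime.mul_left hcop₁ hcop₂
  have hmod : h %ₘ modulusSq Q = (ρ₁ * ρ₂) %ₘ modulusSq Q := by
    apply modByMonic_eq_of_dvd_sub hM
    obtain ⟨k₁, hk₁⟩ := modulusSq_dvd_rep_sub (Q := Q) n₁ ρ₁
    obtain ⟨k₂, hk₂⟩ := modulusSq_dvd_rep_sub (Q := Q) n₂ ρ₂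
    have e1 : rep Q n₁ ρ₁ = ρ₁ + modulusSq Q * k₁ := by rw [← hk₁]; ring
    have e2 : rep Q n₂ ρ₂ = ρ₂ + modulusSq Q * k₂ := by rw [← hk₂]; ring
    rw [hh, e1, e2]
    exact Dvd.intro (k₁ * ρ₂ + ρ₁ * k₂ + modulusSq Q * k₁ * k₂) (by ring)
  have key := traceFn_eq_tFn hQ0 hPQ hhm hhd (hn₁.trans (Nat.le_add_right _ _)) hhcop
  rw [hmod] at key
  rw [← key, hh, traceFn_mul P Q hm₁.ne_zero hm₂.ne_zero]
  rfl

/-- The homomorphism `D ρ = tFn μ ρ − tFn μ 1`. [cite: Schmidt1976, Ch. II §9 (the character `X`)] -/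
def D (P Q : F[X]) (ρ : F[X]) : F :=
  tFn P Q (modulusSq Q).natDegree ρ - tFn P Q (modulusSq Q).natDegree 1

omit [Fintype F] [DecidableEq F] in
/-- `deg 1 < μ` when `deg Q ≥ 1`. [folklore] -/
theorem degree_one_lt_natDegree_modulusSq {Q : F[X]} (hQ0 : Q ≠ 0) (hQ1 : 1 ≤ Q.natDegree) :
    (1 : F[X]).degree < (modulusSq Q).natDegree := by
  rw [degree_one, natDegree_modulusSq hQ0]; exact_mod_cast (by omega : 0 < 2 * Q.natDegree)

omit [Fintype F] [DecidableEq F] in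
/-- A residue is its own remainder: `deg ρ < μ → ρ mod M = ρ`. [folklore] -/
theorem modByMonic_eq_self_of_degree_lt {Q : F[X]} (hQ0 : Q ≠ 0) {ρ : F[X]}
    (hρ : ρ.degree < (modulusSq Q).natDegree) : ρ %ₘ modulusSq Q = ρ := by
  have hM := monic_modulusSq hQ0
  rw [modByMonic_eq_self_iff hM, degree_eq_natDegree hM.ne_zero]
  exact hρ

/-- **`tFn n ρ = tFn n 1 + D ρ`** for every `n ≥ μ`: the dependence on the degree is through the
constant `tFn n 1` only. [cite: Schmidt1976, Ch. II §9, Lemma 9A] -/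
theorem tFn_eq {P Q : F[X]} (hQ0 : Q ≠ 0) (hQ1 : 1 ≤ Q.natDegree) (hPQ : P.natDegree ≤ Q.natDegree)
    {n : ℕ} (hn : (modulusSq Q).natDegree ≤ n) {ρ : F[X]} (hρ : ρ.degree < (modulusSq Q).natDegree)
    (hc : IsCoprime ρ Q) : tFn P Q n ρ = tFn P Q n 1 + D P Q ρ := by
  have h1deg := degree_one_lt_natDegree_modulusSq hQ0 hQ1
  have h1c : IsCoprime (1 : F[X]) Q := isCoprime_one_left
  -- `tFn (μ + n) ρ` computed in two ways
  have e1 := tFn_add hQ0 hPQ le_rfl hn hρ h1deg hc h1c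
  have e2 := tFn_add hQ0 hPQ le_rfl hn h1deg hρ h1c hc
  rw [mul_one, modByMonic_eq_self_of_degree_lt hQ0 hρ] at e1
  rw [one_mul, modByMonic_eq_self_of_degree_lt hQ0 hρ] at e2
  unfold D
  have := e1.symm.trans e2
  linear_combination -this

/-- **`D` is a homomorphism**: `D ((ρ₁ρ₂) mod M) = D ρ₁ + D ρ₂`. [cite: Schmidt1976, Ch. II §9, Lemma 9A] -/
theorem D_mul_mod {P Q : F[X]} (hQ0 : Q ≠ 0) (hQ1 : 1 ≤ Q.natDegree) (hPQ : P.natDegree ≤ Q.natDegree)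
    {ρ₁ ρ₂ : F[X]} (hρ₁ : ρ₁.degree < (modulusSq Q).natDegree) (hρ₂ : ρ₂.degree < (modulusSq Q).natDegree)
    (hc₁ : IsCoprime ρ₁ Q) (hc₂ : IsCoprime ρ₂ Q) :
    D P Q ((ρ₁ * ρ₂) %ₘ modulusSq Q) = D P Q ρ₁ + D P Q ρ₂ := by
  have hM := monic_modulusSq hQ0
  set σ := (ρ₁ * ρ₂) %ₘ modulusSq Q with hσ
  have hσdeg : σ.degree < (modulusSq Q).natDegree := by
    rw [← degree_eq_natDegree hM.ne_zero]; exact degree_modByMonic_lt _ hM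
  have hσc : IsCoprime σ Q := by
    have : σ = ρ₁ * ρ₂ + (-((ρ₁ * ρ₂) /ₘ modulusSq Q)) * modulusSq Q := by
      rw [hσ, modByMonic_eq_sub_mul_div (ρ₁ * ρ₂) (modulusSq Q)]; ring
    rw [this, isCoprime_add_mul_modulusSq_iff Q]
    exact IsCoprime.mul_left hc₁ hc₂
  have h1deg := degree_one_lt_natDegree_modulusSq hQ0 hQ1
  have h1c : IsCoprime (1 : F[X]) Q := isCoprime_one_left
  have e1 := tFn_add hQ0 hPQ le_rfl le_rfl hρ₁ hρ₂ hc₁ hc₂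
  have e2 := tFn_eq hQ0 hQ1 hPQ (n := (modulusSq Q).natDegree + (modulusSq Q).natDegree)
    (Nat.le_add_right _ _) hσdeg hσc
  have e3 := tFn_add hQ0 hPQ le_rfl le_rfl h1deg h1deg h1c h1c
  rw [mul_one, modByMonic_eq_self_of_degree_lt hQ0 h1deg] at e3
  rw [← hσ] at e1
  unfold D at e2 ⊢
  linear_combination e1 - e2 - e3

end Residues

/-! ### §3. The `L`-coefficients and the dichotomy -/

section Dichotomy

variable {F : Type*} [Field F] [Fintype F] [DecidableEq F]

/-- The residues: polynomials of degree `< μ` coprime to `Q`, enumerated by coefficient vectors.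
[folklore] -/
def residues (Q : F[X]) : Finset F[X] :=
  open scoped Classical in
  ((Finset.univ : Finset (Fin (modulusSq Q).natDegree → F)).image lowPoly).filter
    (fun ρ => IsCoprime ρ Q)

/-- Membership in `residues Q`. [folklore] -/
theorem mem_residues {Q ρ : F[X]} :
    ρ ∈ residues Q ↔ ρ.degree < (modulusSq Q).natDegree ∧ IsCoprime ρ Q := by
  classical
  unfold residues
  rw [Finset.mem_filter, Finset.mem_image]
  constructor
  · rintro ⟨⟨w, -, rfl⟩, hc⟩
    exact ⟨degree_lowPoly_lt w, hc⟩
  · rintro ⟨hd, hc⟩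
    exact ⟨⟨fun i => ρ.coeff i, Finset.mem_univ _, (eq_lowPoly_of_degree_lt hd).symm⟩, hc⟩

/-- **Division by `M`**: the monic polynomials of degree `m + μ` are exactly the `k·M + lowPoly w`,
`k` monic of degree `m`, `w ∈ F^μ`, each exactly once. [folklore] -/
theorem sum_monics_add_modulusSq {Q : F[X]} (hQ0 : Q ≠ 0) {B : Type*} [AddCommMonoid B] (m : ℕ)
    (g : F[X] → B) :
    ∑ h ∈ monics (m + (modulusSq Q).natDegree), g h =
      ∑ k ∈ monics m, ∑ w : Fin (modulusSq Q).natDegree → F, g (k * modulusSq Q + lowPoly w) := by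
  classical
  have hM := monic_modulusSq hQ0
  set μ := (modulusSq Q).natDegree with hμ
  have hMdeg' : (modulusSq Q).degree = μ := degree_eq_natDegree hM.ne_zero
  -- injectivity of `(k, w) ↦ k M + lowPoly w`
  have hinj : ∀ {k k' : F[X]} {w w' : Fin μ → F},
      k * modulusSq Q + lowPoly w = k' * modulusSq Q + lowPoly w' → k = k' ∧ w = w' := by
    intro k k' w w' h
    have hdeg : ∀ v : Fin μ → F, (lowPoly v).degree < (modulusSq Q).degree := fun v => by
      rw [hMdeg']; exact degree_lowPoly_lt v
    have hu := div_modByMonic_unique (f := k * modulusSq Q + lowPoly w) k (lowPoly w) hM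
      ⟨by ring, hdeg w⟩
    have hu' := div_modByMonic_unique (f := k * modulusSq Q + lowPoly w) k' (lowPoly w') hM
      ⟨by rw [h]; ring, hdeg w'⟩
    exact ⟨hu.1.symm.trans hu'.1, lowPoly_injective μ (hu.2.symm.trans hu'.2)⟩
  have himage : monics (m + μ) = ((monics m) ×ˢ (Finset.univ : Finset (Fin μ → F))).image
      (fun p => p.1 * modulusSq Q + lowPoly p.2) := by
    ext h
    rw [Finset.mem_image, mem_monics]
    constructor
    · rintro ⟨hhm, hhd⟩
      refine ⟨(h /ₘ modulusSq Q, fun i => (h %ₘ modulusSq Q).coeff i), ?_, ?_⟩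
      · rw [Finset.mem_product, mem_monics]
        refine ⟨⟨?_, ?_⟩, Finset.mem_univ _⟩
        · have hle : (modulusSq Q).degree ≤ h.degree := by
            rw [hMdeg', degree_eq_natDegree hhm.ne_zero, hhd]; exact_mod_cast Nat.le_add_left μ m
          rw [Monic, leadingCoeff_divByMonic_of_monic hM hle]; exact hhm
        · rw [natDegree_divByMonic h hM, hhd, Nat.add_sub_cancel]
      · dsimp only
        rw [← eq_lowPoly_of_degree_lt (hMdeg' ▸ degree_modByMonic_lt h hM), mul_comm,
          add_comm, modByMonic_add_div]
    · rintro ⟨⟨k, w⟩, hkw, rfl⟩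
      rw [Finset.mem_product, mem_monics] at hkw
      obtain ⟨⟨hkm, hkd⟩, -⟩ := hkw
      have hkM : (k * modulusSq Q).Monic := hkm.mul hM
      have hkMd : (k * modulusSq Q).natDegree = m + μ := by rw [hkm.natDegree_mul hM, hkd]
      have hlt : (lowPoly w).degree < (k * modulusSq Q).degree := by
        rw [degree_eq_natDegree hkM.ne_zero, hkMd]
        exact (degree_lowPoly_lt w).trans_le (by exact_mod_cast Nat.le_add_left μ m)
      exact ⟨hkM.add_of_left hlt, by rw [natDegree_add_eq_left_of_degree_lt hlt, hkMd]⟩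
  rw [himage, Finset.sum_image, Finset.sum_product]
  rintro ⟨k, w⟩ - ⟨k', w'⟩ - h
  obtain ⟨h1, h2⟩ := hinj h
  exact Prod.ext h1 h2

/-- **The `L`-coefficients in terms of `D`**: for `Q` of degree `≥ 1`, `deg P ≤ deg Q` and every
`m`, `lsumOf (lam ψ P Q) (m + μ) = q^m · ψ(tFn (m + μ) 1) · Σ_{ρ ∈ residues} ψ(D ρ)`.
[cite: Schmidt1976, Ch. II §9, proof of Lemma 9B] -/
theorem lsumOf_lam_eq (ψ : AddChar F ℂ) {P Q : F[X]} (hQ0 : Q ≠ 0) (hQ1 : 1 ≤ Q.natDegree)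
    (hPQ : P.natDegree ≤ Q.natDegree) (m : ℕ) :
    lsumOf (lam ψ P Q) (m + (modulusSq Q).natDegree) =
      (Fintype.card F : ℂ) ^ m * ψ (tFn P Q (m + (modulusSq Q).natDegree) 1) *
        ∑ ρ ∈ residues Q, ψ (D P Q ρ) := by
  classical
  have hM := monic_modulusSq hQ0
  unfold lsumOf
  rw [sum_monics_add_modulusSq hQ0, Finset.sum_comm]
  -- the value of `λ(k M + ρ)` depends only on `ρ`
  have hval : ∀ (w : Fin (modulusSq Q).natDegree → F) (k : F[X]), k ∈ monics m →
      lam ψ P Q (k * modulusSq Q + lowPoly w) =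
        if IsCoprime (lowPoly w) Q then
          ψ (tFn P Q (m + (modulusSq Q).natDegree) 1) * ψ (D P Q (lowPoly w)) else 0 := by
    intro w k hk
    rw [mem_monics] at hk
    have hρdeg : (lowPoly w).degree < (modulusSq Q).natDegree := degree_lowPoly_lt w
    have hkM : (k * modulusSq Q).Monic := hk.1.mul hM
    have hkMd : (k * modulusSq Q).natDegree = m + (modulusSq Q).natDegree := by
      rw [hk.1.natDegree_mul hM, hk.2]
    have hlt : (lowPoly w).degree < (k * modulusSq Q).degree := by
      rw [degree_eq_natDegree hkM.ne_zero, hkMd]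
      exact hρdeg.trans_le (by exact_mod_cast Nat.le_add_left _ m)
    have hhm : (k * modulusSq Q + lowPoly w).Monic := hkM.add_of_left hlt
    have hhd : (k * modulusSq Q + lowPoly w).natDegree = m + (modulusSq Q).natDegree := by
      rw [natDegree_add_eq_left_of_degree_lt hlt, hkMd]
    have hcopiff : IsCoprime (k * modulusSq Q + lowPoly w) Q ↔ IsCoprime (lowPoly w) Q := by
      rw [add_comm]; exact isCoprime_add_mul_modulusSq_iff Q (lowPoly w) k
    split_ifs with hc
    · rw [lam_eq_psi_traceFn ψ P Q hhm (hcopiff.mpr hc),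
        traceFn_eq_tFn hQ0 hPQ hhm hhd (Nat.le_add_left _ _) (hcopiff.mpr hc)]
      have hmod : (k * modulusSq Q + lowPoly w) %ₘ modulusSq Q = lowPoly w := by
        rw [modByMonic_eq_of_dvd_sub hM (Dvd.intro k (by ring) :
          modulusSq Q ∣ (k * modulusSq Q + lowPoly w) - lowPoly w),
          modByMonic_eq_self_of_degree_lt hQ0 hρdeg]
      rw [hmod, tFn_eq hQ0 hQ1 hPQ (Nat.le_add_left _ _) hρdeg hc, AddChar.map_add_eq_mul]
    · exact lam_eq_zero_of_not_isCoprime ψ P Q hhm (fun h => hc (hcopiff.mp h))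
  rw [Finset.sum_congr rfl fun w _ => Finset.sum_congr rfl fun k hk => hval w k hk]
  simp only [Finset.sum_const, card_monics, nsmul_eq_mul]
  rw [← Finset.mul_sum]
  push_cast
  rw [mul_assoc]
  congr 1
  -- reindex the residues by coefficient vectors
  unfold residues
  rw [Finset.sum_filter, Finset.sum_image fun v _ w _ h => lowPoly_injective _ h, Finset.mul_sum]
  refine Finset.sum_congr rfl fun w _ => ?_
  split_ifs <;> simp

/-- **The orbit argument**: if `ψ(D ρ₀) ≠ 1` for some residue `ρ₀`, then `Σ_{ρ} ψ(D ρ) = 0`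
(multiplication by `ρ₀` modulo `M` permutes the residues and multiplies the sum by `ψ(D ρ₀)`).
[cite: Schmidt1976, Ch. II §9, Lemma 9B] -/
theorem sum_residues_eq_zero (ψ : AddChar F ℂ) {P Q : F[X]} (hQ0 : Q ≠ 0) (hQ1 : 1 ≤ Q.natDegree)
    (hPQ : P.natDegree ≤ Q.natDegree) {ρ₀ : F[X]} (hρ₀ : ρ₀ ∈ residues Q)
    (hne : ψ (D P Q ρ₀) ≠ 1) : ∑ ρ ∈ residues Q, ψ (D P Q ρ) = 0 := by
  classical
  have hM := monic_modulusSq hQ0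
  obtain ⟨hρ₀deg, hρ₀c⟩ := mem_residues.mp hρ₀
  set φ : F[X] → F[X] := fun ρ => (ρ₀ * ρ) %ₘ modulusSq Q with hφ
  -- `φ` maps residues to residues
  have hmaps : ∀ ρ ∈ residues Q, φ ρ ∈ residues Q := by
    intro ρ hρ
    obtain ⟨-, hρc⟩ := mem_residues.mp hρ
    rw [mem_residues]
    refine ⟨?_, ?_⟩
    · rw [← degree_eq_natDegree hM.ne_zero]; exact degree_modByMonic_lt _ hM
    · have : φ ρ = ρ₀ * ρ + (-((ρ₀ * ρ) /ₘ modulusSq Q)) * modulusSq Q := by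
        show (ρ₀ * ρ) %ₘ modulusSq Q = _
        rw [modByMonic_eq_sub_mul_div (ρ₀ * ρ) (modulusSq Q)]; ring
      rw [this, isCoprime_add_mul_modulusSq_iff Q]
      exact IsCoprime.mul_left hρ₀c hρc
  -- `φ` is injective on residues (`ρ₀` is invertible modulo `M`)
  have hlc : Q.leadingCoeff ≠ 0 := leadingCoeff_ne_zero.mpr hQ0
  have hρ₀M : IsCoprime ρ₀ (modulusSq Q) := by
    unfold modulusSq
    refine IsCoprime.pow_right (IsCoprime.mul_right hρ₀c ?_)
    exact ⟨0, C Q.leadingCoeff, by rw [zero_mul, zero_add, ← C_mul, mul_inv_cancel₀ hlc, C_1]⟩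
  have hsub : ∀ a b : F[X], a %ₘ modulusSq Q = b %ₘ modulusSq Q → modulusSq Q ∣ a - b := by
    intro a b hab
    have ha := modByMonic_add_div a (modulusSq Q)
    have hb := modByMonic_add_div b (modulusSq Q)
    refine ⟨a /ₘ modulusSq Q - b /ₘ modulusSq Q, ?_⟩
    calc a - b = (a %ₘ modulusSq Q + modulusSq Q * (a /ₘ modulusSq Q)) -
          (b %ₘ modulusSq Q + modulusSq Q * (b /ₘ modulusSq Q)) := by rw [ha, hb]
      _ = _ := by rw [hab]; ring
  have hinj : ∀ a₁ ∈ residues Q, ∀ a₂ ∈ residues Q, φ a₁ = φ a₂ → a₁ = a₂ := by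
    intro a₁ ha₁ a₂ ha₂ h
    obtain ⟨ha₁deg, -⟩ := mem_residues.mp ha₁
    obtain ⟨ha₂deg, -⟩ := mem_residues.mp ha₂
    have h1 : modulusSq Q ∣ ρ₀ * (a₁ - a₂) := by rw [mul_sub]; exact hsub _ _ h
    have h2 : modulusSq Q ∣ a₁ - a₂ := hρ₀M.symm.dvd_of_dvd_mul_left h1
    have h3 : a₁ - a₂ = 0 := by
      refine eq_zero_of_dvd_of_degree_lt h2 ?_
      rw [degree_eq_natDegree hM.ne_zero]
      exact (degree_sub_le _ _).trans_lt (max_lt ha₁deg ha₂deg)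
    exact sub_eq_zero.mp h3
  have hsurj : ∀ b ∈ residues Q, ∃ a, ∃ (ha : a ∈ residues Q), (fun a _ => φ a) a ha = b := by
    intro b hb
    obtain ⟨a, ha, hab⟩ := Finset.surj_on_of_inj_on_of_card_le (fun a _ => φ a)
      (fun a ha => hmaps a ha) (fun a₁ a₂ ha₁ ha₂ h => hinj a₁ ha₁ a₂ ha₂ h) le_rfl b hb
    exact ⟨a, ha, hab.symm⟩
  -- the sum is multiplied by `ψ(D ρ₀)` under the reindexing
  set S := ∑ ρ ∈ residues Q, ψ (D P Q ρ) with hS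
  have hmul : ψ (D P Q ρ₀) * S = S := by
    rw [hS, Finset.mul_sum]
    refine Finset.sum_bij (fun a _ => φ a) (fun a ha => hmaps a ha)
      (fun a₁ ha₁ a₂ ha₂ h => hinj a₁ ha₁ a₂ ha₂ h) hsurj ?_
    intro a ha
    obtain ⟨hadeg, hac⟩ := mem_residues.mp ha
    show ψ (D P Q ρ₀) * ψ (D P Q a) = ψ (D P Q ((ρ₀ * a) %ₘ modulusSq Q))
    rw [← AddChar.map_add_eq_mul, ← D_mul_mod hQ0 hQ1 hPQ hρ₀deg hadeg hρ₀c hac]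
  have : (ψ (D P Q ρ₀) - 1) * S = 0 := by rw [sub_mul, one_mul, hmul, sub_self]
  rcases mul_eq_zero.mp this with h | h
  · exact absurd (sub_eq_zero.mp h) hne
  · exact h

/-- **The `L`-function is a polynomial of degree `< μ = 2 deg Q` in the non-degenerate case**:
if `ψ(D ρ₀) ≠ 1` for some residue `ρ₀`, then `lsumOf (lam ψ P Q) n = 0` for every `n ≥ μ`.
[cite: Schmidt1976, Ch. II §9, Lemma 9B and Theorem 2G' (for rational arguments)] -/
theorem lsumOf_lam_eq_zero (ψ : AddChar F ℂ) {P Q : F[X]} (hQ0 : Q ≠ 0) (hQ1 : 1 ≤ Q.natDegree)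
    (hPQ : P.natDegree ≤ Q.natDegree) (hgood : ∃ ρ₀ ∈ residues Q, ψ (D P Q ρ₀) ≠ 1) :
    ∀ n, (modulusSq Q).natDegree ≤ n → lsumOf (lam ψ P Q) n = 0 := by
  intro n hn
  obtain ⟨m, rfl⟩ : ∃ m, n = m + (modulusSq Q).natDegree := ⟨n - (modulusSq Q).natDegree, by omega⟩
  obtain ⟨ρ₀, hρ₀, hne⟩ := hgood
  rw [lsumOf_lam_eq ψ hQ0 hQ1 hPQ m, sum_residues_eq_zero ψ hQ0 hQ1 hPQ hρ₀ hne, mul_zero]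

/-- **The degenerate case**: if `D ρ = 0` for every residue `ρ`, then `λ(h) = ψ(tFn (deg h) 1)`
for every monic `h` of degree `≥ μ` coprime to `Q` — `λ` depends only on the degree.
[cite: Schmidt1976, Ch. II §9 (the case of a trivial character)] -/
theorem lam_eq_const_of_D_eq_zero (ψ : AddChar F ℂ) {P Q : F[X]} (hQ0 : Q ≠ 0) (hQ1 : 1 ≤ Q.natDegree)
    (hPQ : P.natDegree ≤ Q.natDegree) (hbad : ∀ ρ ∈ residues Q, D P Q ρ = 0) {h : F[X]}
    (hm : h.Monic) (hn : (modulusSq Q).natDegree ≤ h.natDegree) (hc : IsCoprime h Q) :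
    lam ψ P Q h = ψ (tFn P Q h.natDegree 1) := by
  have hM := monic_modulusSq hQ0
  have hρdeg : (h %ₘ modulusSq Q).degree < (modulusSq Q).natDegree := by
    rw [← degree_eq_natDegree hM.ne_zero]; exact degree_modByMonic_lt _ hM
  have hρc : IsCoprime (h %ₘ modulusSq Q) Q := by
    have : h %ₘ modulusSq Q = h + (-(h /ₘ modulusSq Q)) * modulusSq Q := by
      rw [modByMonic_eq_sub_mul_div h (modulusSq Q)]; ring
    rw [this, isCoprime_add_mul_modulusSq_iff Q]
    exact hc
  rw [lam_eq_psi_traceFn ψ P Q hm hc, traceFn_eq_tFn hQ0 hPQ hm rfl hn hc,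
    tFn_eq hQ0 hQ1 hPQ hn hρdeg hρc, hbad _ (mem_residues.mpr ⟨hρdeg, hρc⟩), add_zero]

/-- For an additive character with trivial kernel (e.g. any non-trivial character of `ℤ/pℤ`),
the dichotomy reads: EITHER some residue has `D ρ₀ ≠ 0` and all `L`-coefficients of degree
`≥ μ` vanish, OR `D ≡ 0` on the residues. [folklore] -/
theorem lsumOf_lam_eq_zero_or (ψ : AddChar F ℂ) (hψ : ∀ a : F, ψ a = 1 → a = 0) {P Q : F[X]}
    (hQ0 : Q ≠ 0) (hQ1 : 1 ≤ Q.natDegree) (hPQ : P.natDegree ≤ Q.natDegree) :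
    (∀ n, (modulusSq Q).natDegree ≤ n → lsumOf (lam ψ P Q) n = 0) ∨
      (∀ ρ ∈ residues Q, D P Q ρ = 0) := by
  by_cases h : ∀ ρ ∈ residues Q, D P Q ρ = 0
  · exact Or.inr h
  · left
    push Not at h
    obtain ⟨ρ₀, hρ₀, hne⟩ := h
    exact lsumOf_lam_eq_zero ψ hQ0 hQ1 hPQ ⟨ρ₀, hρ₀, fun h1 => hne (hψ _ h1)⟩

end Dichotomy

end RationalExpSum

end Literature.NumberTheory.LFunctions
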